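import Summits.CriticalPhenomena.SAWScalingLimit.Theses.SAWReversalUpgrade
import Summits.CriticalPhenomena.SAWScalingLimit.Theorems.SAWReversalUpgradeForwardDrivingDrivingCoupling
import Summits.CriticalPhenomena.SAWScalingLimit.Theorems.SAWReversalUpgradeForwardDrivingLawOfCoupling
import HarnessLib

/-!
# `ForwardDriving` reduced to the mesoscopic key estimate (line `lsw-engine`, crux stmt-CriticalPhenomena-18003)

The composition of the line `lsw-engine` for the crux `ForwardDriving` of route SAWReversalUpgrade, with
its two provable stubs LANDED and imported (`stub_drivingCoupling`, p158449: the Lawler–Schramm–Werner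
engine application; `stub_lawOfCoupling`, p159272: couplings ⇒ convergence in law + Brownian scaling),
leaving the single open stub `stub_mesoscopicKeyEstimate` — the LSW key estimate for the boundary-attached
critical `ℤ²` SAW in the normal form `SkorokhodEmbedding.RawDrivingData.IsValid` with `κ = 8/3` (the
conformal-invariance content of the SAW conjecture) — as an explicit HYPOTHESIS:
`ForwardDriving_of_keyEstimate : (statement of stub_mesoscopicKeyEstimate) → ForwardDriving`, sorry-free.
So the crux is now kernel-reduced to that one statement. [cite: LawlerSchrammWerner2004, Theorem 3.7]
-/

noncomputable section

namespace Summit.CriticalPhenomena.SAWScalingLimit.Cruxes.ForwardDriving.LswEngine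

open scoped BigOperators Topology Classical MeasureTheory ProbabilityTheory NNReal ENNReal
open scoped Literature.Probability.RandomPlanarGeometry.PathBorel
open Filter Set Function TopologicalSpace MeasureTheory

/-- **The crux `ForwardDriving` from the mesoscopic key estimate alone** (S3 ∘ S2 ∘ hypothesis, instance by
instance in `(D, a, b, φ, att, T)`): if for every Dobrushin domain, endpoint approximation, chordal
uniformizer, eventually-standard attachment and horizon the attached critical SAW carries valid
Lawler–Schramm–Werner raw driving data with `κ = 8/3` (mesoscopic scale → 0, truncation probability → 0,
horizon window), then its driving function converges in law on every `[0, T]` to `√(8/3)·B`.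
[cite: LawlerSchrammWerner2004, Theorem 3.7] -/
theorem ForwardDriving_of_keyEstimate :
    (∀ (D : Literature.Probability.RandomPlanarGeometry.DobrushinDomain) (a b : ℝ → Literature.Probability.LatticeModels.Site 2), Literature.Probability.RandomPlanarGeometry.SAW.IsEndpointApprox D a b → ∀ (φ : Literature.Probability.RandomPlanarGeometry.ConformalEquiv UpperHalfPlane.upperHalfPlaneSet D.carrier), D.IsChordalUniformizing φ → ∀ (att : ((δ : ℝ) → Literature.Probability.RandomPlanarGeometry.SAW.DomainSAW (D).carrier δ (a δ) (b δ) → Literature.Probability.RandomPlanarGeometry.Curve ℂ)), (∀ᶠ δ in (nhdsWithin (0:ℝ) (Set.Ioi 0)), ∀ γ : Literature.Probability.RandomPlanarGeometry.SAW.DomainSAW (D).carrier δ (a δ) (b δ), (let a₁ := (D).pt 0; let b₁ := (D).pt 1; let P₁ : C(unitInterval, ℂ) := (γ.walk.toCurve (Literature.Probability.LatticeModels.meshPoint δ)); let R₁ := fun u : ℝ => P₁ (Set.projIcc (0:ℝ) 1 zero_le_one u); let φ₁ := (φ).boundaryExtension; let ψ₁ := Function.invFunOn φ₁ {z : ℂ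 | 0 ≤ z.im}; let e₁ : ℝ := min δ (1/2); let A₁ := fun z : ℂ => (‖z‖ : ℂ) * Complex.exp (Complex.I * ((e₁ : ℂ) + (1 - 2 * (e₁ : ℂ) / (Real.pi : ℂ)) * (Complex.arg z : ℂ))); let Z₁ := fun u : ℝ => @ite ℂ (R₁ u = b₁) (Classical.propDecidable _) b₁ (φ₁ (A₁ (ψ₁ (R₁ u)))); let i₁ := sSup ({(0:ℝ)} ∪ {u | u ∈ Set.Icc (0:ℝ) 1 ∧ R₁ u = a₁}); let j₁ := sInf ({(1:ℝ)} ∪ {u | u ∈ Set.Icc (0:ℝ) 1 ∧ R₁ u = b₁}); let M₁ := Z₁ '' Set.Icc i₁ j₁; let p₁ := A₁ (ψ₁ (R₁ i₁)); let q₁ := A₁ (ψ₁ (R₁ j₁)); let s₁ := sInf {s | s ∈ Set.Ioc (0:ℝ) 1 ∧ φ₁ ((s : ℂ) * p₁) ∈ M₁}; let r₁ := sSup ({(1:ℝ)} ∪ {r | 1 ≤ r ∧ R₁ j₁ ≠ b₁ ∧ φ₁ ((r : ℂ) * q₁) ∈ M₁}); let u₁ := sInf {u | u ∈ Set.Icc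 i₁ j₁ ∧ Z₁ u = φ₁ ((s₁ : ℂ) * p₁)}; let v₁ := sSup ({u | u ∈ Set.Icc i₁ j₁ ∧ R₁ j₁ = b₁ ∧ u = j₁} ∪ {u | u ∈ Set.Icc i₁ j₁ ∧ R₁ j₁ ≠ b₁ ∧ Z₁ u = φ₁ ((r₁ : ℂ) * q₁)}); let S₁ := ((({a₁, b₁} ∪ ((fun s : ℝ => φ₁ ((s : ℂ) * p₁)) '' Set.Ioc 0 s₁)) ∪ (Z₁ '' Set.Icc u₁ v₁)) ∪ ((fun r : ℝ => φ₁ ((r : ℂ) * q₁)) '' {r | r₁ ≤ r ∧ R₁ j₁ ≠ b₁})); Function.Injective (att δ γ) ∧ (att δ γ).source = a₁ ∧ (att δ γ).target = b₁ ∧ (∀ t : unitInterval, (att δ γ) t = a₁ ∨ (att δ γ) t = b₁ ∨ (att δ γ) t ∈ (D).carrier) ∧ (u₁ < v₁ → Set.range (att δ γ) = S₁) ∧ (¬ u₁ < v₁ → Set.range (att δ γ) = {a₁, b₁} ∪ ((fun y : ℝ => φ₁ (Complex.I * (y : ℂ))) '' Set.Ioi 0)))) → ∀ T : NNReal, (∃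 (Λ : Type) (_ : DecidableEq Λ) (_ : MeasurableSpace Λ) (_ : Countable Λ) (_ : MeasurableSingletonClass Λ) (C₁ C₂ : ℝ) (RD : (δ : ℝ) → Literature.Probability.RandomPlanarGeometry.SkorokhodEmbedding.RawDrivingData (Literature.Probability.RandomPlanarGeometry.SAW.DomainSAW D.carrier δ (a δ) (b δ)) Λ) (N : ℝ → ℕ), 0 ≤ C₁ ∧ 0 ≤ C₂ ∧ (∀ δ, (RD δ).P = Literature.Probability.RandomPlanarGeometry.SAW.law D.carrier δ (a δ) (b δ) ∧ (RD δ).κ = 8/3 ∧ (RD δ).C₁ ≤ C₁ ∧ (RD δ).C₂ ≤ C₂ ∧ (RD δ).drv = fun γ => (⟨Literature.Probability.RandomPlanarGeometry.drivingFunction φ (Literature.Probability.RandomPlanarGeometry.CurveClass.mk (att δ γ)), Literature.Probability.RandomPlanarGeometry.continuous_drivingFunction φ (Literature.Probability.RandomPlanarGeometry.CurveClass.mk (att δ γ))⟩ : C(NNReal, ℝ))) ∧ Filter.Tendsto (fun δ => (RD δ).δ) (nhdsWithin 0 (Set.Ioi 0)) (nhds 0) ∧ Filter.Tendsto (fun δ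 => (RD δ).P {ω | ∃ k < N δ, ((RD δ).dval (k+1) ω - (RD δ).dval k ω)^2 + (((RD δ).tcap (k+1) ω : ℝ) - (RD δ).tcap k ω) < (RD δ).δ^2}) (nhdsWithin 0 (Set.Ioi 0)) (nhds 0) ∧ ∀ᶠ δ in nhdsWithin 0 (Set.Ioi 0), ∃ (_ : Fintype (Literature.Probability.RandomPlanarGeometry.SAW.DomainSAW D.carrier δ (a δ) (b δ))), (RD δ).IsValid (N δ) ∧ (8/3 + 2) * (T : ℝ) + 1 ≤ (N δ : ℝ) * (RD δ).δ^2 ∧ (N δ : ℝ) * (RD δ).δ^2 ≤ (8/3 + 2) * (T : ℝ) + 2)) → Summit.CriticalPhenomena.SAWScalingLimit.Theses.SAWReversalUpgrade.ForwardDriving := by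
  intro hS1 D a b happ φ hφ att hatt T
  exact stub_lawOfCoupling D a b φ att T
    (stub_drivingCoupling D a b φ att T (hS1 D a b happ φ hφ att hatt T))

end Summit.CriticalPhenomena.SAWScalingLimit.Cruxes.ForwardDriving.LswEngine

end
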